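import Summits.BirchSwinnertonDyer.BirchSwinnertonDyer.Theorems.PublishedInputsGreenbergKerGCountOfCassels
import Summits.BirchSwinnertonDyer.Rank1Residual.Additive.LocalTowerKernelCardEqTamagawaCyclotomic
import Summits.BirchSwinnertonDyer.Rank1Residual.Iwasawa.SelmerCardOfLevelZeroControl
import Summits.BirchSwinnertonDyer.Rank1Residual.X5.TwoAdicTargets
import Literature.NumberTheory.EllipticCurves.Greenberg1999.ControlLocalKernelsLayer
import Literature.NumberTheory.EllipticCurves.BSDRootNumberSmallConductorProofs
import Literature.NumberTheory.EllipticCurves.TamagawaNeZeroProofs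
import Literature.NumberTheory.EllipticCurves.TamagawaSubgroupProofs
import Literature.NumberTheory.EllipticCurves.FrobeniusEndomorphism
import HarnessLib

/-!
# Route `ByReductionTypeAtTwo` (K4), TOWER road — Greenberg's Thm. 4.1 over `ℚ` (the `hEC` binder at `p = 2`)
# is KERNEL ∘ {ONE local count}: the rank-`0` Euler-characteristic formula from Lemma 3.4 at layer `0`

Cell `bsd-2adic`, seat `bsd-2adic-tower-1` (GEN 25), `--supports stmt-BirchSwinnertonDyer-19271` (helper). THEOREMS
ONLY: no definition, no new named fact, no `sorry`; closes nothing by itself; BSD is not proved by any of this.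

R. Greenberg, *Iwasawa theory for elliptic curves*, LNM 1716 (1999), Thm. 4.1 (p. 85; proof §4 pp. 102–108): for
`E/ℚ` with good ORDINARY reduction at `p` and `Sel_E(ℚ)_p` finite,
`f_E(0) ∼ (∏_{v bad} c_v^{(p)}) · #Ẽ(𝔽_p)_p² · #Sel_E(ℚ)_p / #E(ℚ)_p²`. In the tree this is the PRINT binder
`hEC : X5.O1.TwoAdicEulerCharRankZero W 0` (read at `p = 2`, referee C R256) of every TOWER `BSD₂` door
(`KatoHalfPinch.bsdp_two_of_towerGap_of_*`, the 852 `TowerClass<label>` displays) and the named fact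
`greenberg_charValue_rankZero` elsewhere. State of the kernel road in the `E(ℚ)[p] = 0` case (where `#E(ℚ)_p = 1`):

* GLOBAL assembly (cell bsd-inputs, seat k4-p1 g4): `InputsGreenbergKerG.constantCoeff_charGenerator_eq_ordinary_rat` —
  `f(0) = u · #Sel_{p^∞}(E/ℚ) · ∏_{v ∈ S} #𝒦_{v,0}[p^∞]` for any finite `S ⊇ {bad} ∪ {p}` (Lemmas 4.2–4.7, Cassels, `(Sel_∞)_γ = 0`;
  its finiteness input at `v ∣ p` is this lineage's `GoodOrdTower.exists_natCard_localTowerKerPrimary_le`);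
* Lemma 3.3 EXACT at every `v ∤ p` (cell b2b-bsdres): `Rank1Residual.Additive.natCard_localTowerKerPrimary_zero_eq_pow_of_isCyclotomic` —
  `#𝒦_{v,0}[p^∞] = p^{ord_p c_v}` (any number field, any reduction type, cyclotomic `κ`);
* Lemma 3.4 at layer `0`, `#𝒦_{p,0}[p^∞] = #Ẽ(𝔽_p)_p²` — the ONE local count not yet in the kernel (named fact
  `Greenberg1999.lemma34_natCard_localTowerKerPrimary_eq_rat`, all layers; the tree proves `= ⊥` when `p ∤ #Ẽ(𝔽_p)` and the
  uniform bound `≤ #SF²`, `…GoodOrdTowerControlLayerBound[P]`).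

This file is the bookkeeping that turns these into Thm. 4.1 modulo that single count:

* §1 `constantCoeff_charGenerator_eq_of_layerZeroCount` (every `p`): from the layer-`0` count at the place above `p`,
  **`f(0) = u · #Sel_{p^∞}(E/ℚ) · p^{ord_p ∏_ℓ c_ℓ} · (p^{ord_p #Ẽ(𝔽_p)})²`** (`W.tamagawaProduct`, `W.reductionPointCount p`).
* §2 `twoAdicEulerCharRankZero_of_layerZeroCount` / `…_of_lemma34` / `…_of_lemma34_of_irr`: at `p = 2`, on
  {`GoodOrd W 2`, `E(ℚ)[2] = 0`} (⊇ the `E[2]`-irreducible locus), **`TwoAdicEulerCharRankZero W 0` follows from the layer-`0`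
  count**, in particular from the displayed named fact `h34` — so on every door carrying both `hEC` and `h34` the former is
  now derivable from the latter.

HONEST FRAMING: conditional on ONE local count (hypothesis / named fact by name); the `E(ℚ)[p] ≠ 0` case of Thm. 4.1
(Prop. 4.9 road) is untouched; nothing is re-keyed; no item closes; BSD is not proved by any of this.

References: [GreenbergLNM1716] Thm. 4.1 (p. 85), §3 Lemmas 3.3–3.4 (pp. 86–89), §4 Lemmas 4.2–4.7 (pp. 102–108);
[SilvermanAEC2009] VII.6 Cor. 6.2, VIII.1 Rem. 1.3.
-/

set_option autoImplicit false
-- justification: the mandated namespace `Summit.BirchSwinnertonDyer.BirchSwinnertonDyer.Theorems`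
-- (single-conjunct summit, Sub = Summit) repeats a segment by design (D-0017).
set_option linter.dupNamespace false

noncomputable section

open scoped Classical NumberField

open NumberField IsDedekindDomain Field WeierstrassCurve Literature.NumberTheory.EllipticCurves
  Literature.NumberTheory.EllipticCurves.Rank1Residual Literature.NumberTheory.EllipticCurves.IwasawaAlgebra
  Rat.HeightOneSpectrum

namespace Summit.BirchSwinnertonDyer.BirchSwinnertonDyer.Theorems.GreenbergEulerChar

/-! ## §0 Bookkeeping -/

/-- `ord_p` of a product of non-zero naturals is the sum of the `ord_p`. [folklore] -/
private theorem padicValNat_prod {ι : Type*} (p : ℕ) [Fact p.Prime] (s : Finset ι) (f : ι → ℕ)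
    (hf : ∀ i ∈ s, f i ≠ 0) : padicValNat p (∏ i ∈ s, f i) = ∑ i ∈ s, padicValNat p (f i) := by
  induction s using Finset.induction_on with
  | empty => simp
  | insert a s ha ih =>
    rw [Finset.prod_insert ha, Finset.sum_insert ha,
      padicValNat.mul (hf a (Finset.mem_insert_self a s))
        (Finset.prod_ne_zero_iff.mpr fun i hi ↦ hf i (Finset.mem_insert_of_mem hi)),
      ih fun i hi ↦ hf i (Finset.mem_insert_of_mem hi)]

/-- An additive group without `p`-torsion has trivial `p`-primary component. [folklore] -/
private theorem natCard_primaryComponent_eq_one_of_noTorsion {A : Type*} [AddCommGroup A] (p : ℕ)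
    (hA : ∀ x : A, p • x = 0 → x = 0) : Nat.card (AddCommGroup.primaryComponent A p) = 1 := by
  have hk : ∀ (k : ℕ) (x : A), p ^ k • x = 0 → x = 0 := by
    intro k
    induction k with
    | zero => intro x hx; simpa using hx
    | succ k ih =>
      intro x hx
      rw [pow_succ, mul_smul] at hx
      exact ih x (by
        have := hA (p ^ k • x) (by rw [smul_comm] at hx; exact hx)
        exact this)
  haveI : Subsingleton (AddCommGroup.primaryComponent A p) := ⟨fun x y ↦ by
    obtain ⟨k, hx⟩ := (AddCommGroup.mem_primaryComponent).mp x.2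
    obtain ⟨l, hy⟩ := (AddCommGroup.mem_primaryComponent).mp y.2
    exact Subtype.ext ((hk k x.1 hx).trans (hk l y.1 hy).symm)⟩
  exact Nat.card_of_subsingleton 0

/-- The place of `ℚ` above the rational prime `p` contains `p`. [folklore] -/
private theorem natCast_mem_placeOfPrime (p : ℕ) [hp : Fact p.Prime] :
    ((p : ℕ) : 𝓞 ℚ) ∈ (primesEquiv.symm ⟨p, hp.out⟩ : HeightOneSpectrum (𝓞 ℚ)).asIdeal := by
  set v : HeightOneSpectrum (𝓞 ℚ) := primesEquiv.symm ⟨p, hp.out⟩ with hv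
  have h := natCast_natGenerator_mem v
  have hgen : natGenerator v = p := by
    change ((primesEquiv v : Nat.Primes) : ℕ) = p
    rw [hv, Equiv.apply_symm_apply]
  rwa [hgen] at h

/-- Over `ℚ` a finite place containing the prime `p` is THE place of `p`. [folklore] -/
private theorem eq_of_natCast_mem {p : ℕ} (hp : p.Prime) {v w : HeightOneSpectrum (𝓞 ℚ)}
    (hv : ((p : ℕ) : 𝓞 ℚ) ∈ v.asIdeal) (hw : ((p : ℕ) : 𝓞 ℚ) ∈ w.asIdeal) : v = w :=
  primesEquiv.injective (Subtype.ext ((primesEquiv_eq_of_natCast_mem v hp hv).trans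
    (primesEquiv_eq_of_natCast_mem w hp hw).symm))

/-- The local Tamagawa number of `W/ℚ` at a finite place is non-zero (Silverman, *AEC*, Cor. VII.6.2; transport to `ℚ_ℓ`).
[cite: SilvermanAEC2009, VII.6 Cor. 6.2] -/
private theorem localTamagawaNumber_ne_zero_rat (W : WeierstrassCurve ℚ) [W.IsElliptic] (v : HeightOneSpectrum (𝓞 ℚ)) :
    (W.baseChange (v.adicCompletion ℚ)).localTamagawaNumber (v.adicCompletionIntegers ℚ) ≠ 0 := by
  haveI : Fact (Nat.Prime (primesEquiv v : ℕ)) := ⟨(primesEquiv v).2⟩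
  rw [← localTamagawaNumber_padic_eq_holds W v (primesEquiv v : ℕ) rfl]
  exact localTamagawaNumber_padic_ne_zero_holds (primesEquiv v : ℕ) (W.baseChange ℚ_[primesEquiv v])

/-! ## §1 Theorem 4.1 over `ℚ` (`E(ℚ)[p] = 0`) from the layer-`0` count at `p` -/

/-- **Greenberg LNM 1716 Thm. 4.1 over `ℚ` at a good ORDINARY `p` with `E(ℚ)[p] = 0`, from Lemma 3.4 at layer `0`.**
For `W/ℚ` globally minimal and elliptic, `GoodOrd W p`, `κ` the cyclotomic `ℤ_p`-extension with topological generator `γ`,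
`Sel_{p^∞}(E/ℚ)` finite, `E(ℚ)[p] = 0`, a Pontryagin-dual datum `D` with `char X(E/ℚ_∞) = (f)`, GIVEN the layer-`0` local count
`#𝒦_{v,0}[p^∞] = (p^{ord_p #Ẽ(𝔽_p)})²` at the place `v ∋ p` (Lemma 3.4, `n = 0`): `X` is finitely generated `Λ`-torsion and
**`f(0) = u · #Sel_{p^∞}(E/ℚ) · p^{ord_p ∏_ℓ c_ℓ} · (p^{ord_p #Ẽ(𝔽_p)})²`**, `u ∈ ℤ_pˣ`. Assembly of
`InputsGreenbergKerG.constantCoeff_charGenerator_eq_ordinary_rat` (Thm. 4.1 modulo the local orders) with the EXACT Lemma 3.3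
`Rank1Residual.Additive.natCard_localTowerKerPrimary_zero_eq_pow_of_isCyclotomic` at the bad places and `c_v = 1` at the good ones.
[cite: GreenbergLNM1716, Thm. 4.1 (p. 85); §3 Lemmas 3.3–3.4 (pp. 86–89); §4 Lemmas 4.2–4.7 (pp. 102–108)] -/
theorem constantCoeff_charGenerator_eq_of_layerZeroCount (p : ℕ) [hp : Fact p.Prime] (W : WeierstrassCurve ℚ)
    [W.IsGloballyMinimal] [W.IsElliptic] (hgo : GoodOrd W p) (κ : ZpExtension ℚ p) (hκ : κ.IsCyclotomic)
    {γ : absoluteGaloisGroup ℚ} (hγ : κ.IsTopGenerator γ) (D : W.SelmerDualData κ γ) [Finite (W.selmerGroupPInfty p)]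
    (hK : ∀ P : W.toAffine.Point, p • P = 0 → P = 0)
    (h34 : ∀ v : HeightOneSpectrum (𝓞 ℚ), ((p : ℕ) : 𝓞 ℚ) ∈ v.asIdeal →
      Nat.card (W.localTowerKerPrimary κ (v.adicCompletion ℚ) 0) = (p ^ padicValNat p (W.reductionPointCount p)) ^ 2)
    (f : IwasawaAlgebra p) (hf : Module.charIdeal (IwasawaAlgebra p) D.X = Ideal.span {f}) :
    Module.Finite (IwasawaAlgebra p) D.X ∧ Module.IsTorsion (IwasawaAlgebra p) D.X ∧
      ∃ u : ℤ_[p]ˣ, PowerSeries.constantCoeff f =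
        u * Nat.card (W.selmerGroupPInfty p) *
          (p ^ padicValNat p W.tamagawaProduct * (p ^ padicValNat p (W.reductionPointCount p)) ^ 2 : ℕ) := by
  have hord : W.HasGoodReductionAtPrime p ∧ ¬ ((p : ℕ) : ℤ) ∣ W.frobeniusTrace p := hgo
  -- the place `v₀` of `p` and the finite set `S = {bad places} ∪ {v₀}`
  set v₀ : HeightOneSpectrum (𝓞 ℚ) := primesEquiv.symm ⟨p, hp.out⟩ with hv₀def
  have hv₀ : ((p : ℕ) : 𝓞 ℚ) ∈ v₀.asIdeal := natCast_mem_placeOfPrime p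
  have hbad : (W.badPlaces (𝓞 ℚ)).Finite := W.finite_badPlaces_holds (𝓞 ℚ)
  let S : Finset (HeightOneSpectrum (𝓞 ℚ)) := hbad.toFinset ∪ {v₀}
  have hv₀S : v₀ ∈ S := Finset.mem_union_right _ (Finset.mem_singleton_self v₀)
  have hgoodS : ∀ v ∉ S, W.HasGoodReductionAt v := fun v hv ↦ by
    by_contra h
    exact hv (Finset.mem_union_left _ (hbad.mem_toFinset.mpr (show v ∈ W.badPlaces (𝓞 ℚ) from h)))
  have hS : ∀ v ∉ S, ((p : ℕ) : 𝓞 ℚ) ∉ v.asIdeal ∧ W.HasGoodReductionAt v := fun v hv ↦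
    ⟨fun hpv ↦ hv (by rw [eq_of_natCast_mem hp.out hpv hv₀]; exact hv₀S), hgoodS v hv⟩
  -- Thm 4.1 modulo the local orders
  obtain ⟨hFG, hX, u, hu⟩ :=
    InputsGreenbergKerG.constantCoeff_charGenerator_eq_ordinary_rat p W hgo κ hκ hγ D hK S hS f hf
  refine ⟨hFG, hX, u, ?_⟩
  rw [hu]
  congr 1
  -- evaluate the local orders
  let c : HeightOneSpectrum (𝓞 ℚ) → ℕ := fun v ↦
    (W.baseChange (v.adicCompletion ℚ)).localTamagawaNumber (v.adicCompletionIntegers ℚ)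
  have hsplit := Finset.mul_prod_erase S (fun v ↦ Nat.card (W.localTowerKerPrimary κ (v.adicCompletion ℚ) 0)) hv₀S
  have hne : ∀ v ∈ S.erase v₀, ((p : ℕ) : 𝓞 ℚ) ∉ v.asIdeal := fun v hv hpv ↦
    (Finset.mem_erase.mp hv).1 (eq_of_natCast_mem hp.out hpv hv₀)
  have herase : ∏ v ∈ S.erase v₀, Nat.card (W.localTowerKerPrimary κ (v.adicCompletion ℚ) 0) =
      p ^ ∑ v ∈ S.erase v₀, padicValNat p (c v) := by
    rw [← Finset.prod_pow_eq_pow_sum]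
    refine Finset.prod_congr rfl fun v hv ↦ ?_
    exact Rank1Residual.Additive.natCard_localTowerKerPrimary_zero_eq_pow_of_isCyclotomic W hκ (hne v hv)
  -- `∑_{v ∈ S ∖ v₀} ord_p c_v = ord_p ∏_ℓ c_ℓ`
  have hc₀ : c v₀ = 1 :=
    W.localTamagawaNumber_eq_one_of_hasGoodReductionAt_holds v₀
      (W.hasGoodReductionAt_of_hasGoodReductionAtPrime v₀ hv₀ hord.1)
  have htam : W.tamagawaProduct = ∏ v ∈ S.erase v₀, c v := by
    have hsupp : (Function.mulSupport c) ⊆ (S : Set (HeightOneSpectrum (𝓞 ℚ))) := by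
      intro v hv
      by_contra hvS
      exact hv (W.localTamagawaNumber_eq_one_of_hasGoodReductionAt_holds v (hgoodS v hvS))
    change ∏ᶠ v, c v = _
    rw [finprod_eq_prod_of_mulSupport_subset c hsupp, ← Finset.mul_prod_erase S c hv₀S, hc₀, one_mul]
  have hsum : ∑ v ∈ S.erase v₀, padicValNat p (c v) = padicValNat p W.tamagawaProduct := by
    rw [htam, padicValNat_prod p _ c fun v _ ↦ localTamagawaNumber_ne_zero_rat W v]
  simp only [← hsplit, herase, hsum, h34 v₀ hv₀, Nat.cast_mul, Nat.cast_pow]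
  ring

/-! ## §2 The reading at `p = 2`: `TwoAdicEulerCharRankZero W 0` on {`GoodOrd W 2`, `E(ℚ)[2] = 0`} -/

open Summit.BirchSwinnertonDyer.Rank1Residual.X5.O1 Literature.NumberTheory.EllipticCurves.Greenberg1999

/-- **`hEC` from the layer-`0` count.** For `W/ℚ` globally minimal and elliptic with NO rational `2`-torsion, Greenberg's
rank-`0` Euler-characteristic formula at `2` in the tree's display shape `TwoAdicEulerCharRankZero W 0` (the `hEC` binder of the
TOWER `BSD₂` doors) follows from the single layer-`0` local count `#𝒦_{v,0}[2^∞] = (2^{ord₂ #Ẽ(𝔽₂)})²` at the place `v ∋ 2` for the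
cyclotomic `ℤ₂`-extension (Lemma 3.4, `n = 0`; at a good ordinary `2`, `#Ẽ(𝔽₂) ∈ {2, 4}` so the value is `4` or `16`).
`#E(ℚ)_2 = 1` and `#Ẽ(𝔽₂)_2 = 2^{ord₂ #Ẽ(𝔽₂)}` are bookkeeping. [cite: GreenbergLNM1716, Thm. 4.1 (p. 85); §3 Lemma 3.4 (p. 89)] -/
theorem twoAdicEulerCharRankZero_of_layerZeroCount (W : WeierstrassCurve ℚ) [W.IsElliptic] [W.IsGloballyMinimal]
    (hK : ∀ P : W.toAffine.Point, 2 • P = 0 → P = 0)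
    (h34 : GoodOrd W 2 → ∀ κ : ZpExtension ℚ 2, κ.IsCyclotomic → ∀ v : HeightOneSpectrum (𝓞 ℚ),
      ((2 : ℕ) : 𝓞 ℚ) ∈ v.asIdeal →
      Nat.card (W.localTowerKerPrimary κ (v.adicCompletion ℚ) 0) = (2 ^ padicValNat 2 (W.reductionPointCount 2)) ^ 2) :
    TwoAdicEulerCharRankZero W 0 := by
  intro hord κ γ hκ hγ _ D _ _ fE hfE hSel
  haveI := hSel
  have hgo : GoodOrd W 2 := hord
  obtain ⟨-, -, u, hu⟩ := constantCoeff_charGenerator_eq_of_layerZeroCount 2 W hgo κ hκ hγ D hK (h34 hgo κ hκ) fE hfE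
  refine ⟨u, ?_⟩
  -- `#E(ℚ)_2 = 1`, `#Ẽ(𝔽₂)_2 = 2^{ord₂ #Ẽ(𝔽₂)}`
  have htors : Nat.card (AddCommGroup.primaryComponent W.toAffine.Point 2) = 1 :=
    natCard_primaryComponent_eq_one_of_noTorsion 2 hK
  haveI : Finite ((integralModelInt W).map (Int.castRingHom (ZMod 2))).toAffine.Point :=
    WeierstrassCurve.finite_point _
  have hred : Nat.card (AddCommGroup.primaryComponent
      ((integralModelInt W).map (Int.castRingHom (ZMod 2))).toAffine.Point 2) =
      2 ^ padicValNat 2 (W.reductionPointCount 2) := by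
    rw [card_addPrimaryComponent_eq_pow, Nat.factorization_def _ Fact.out]
    rfl
  have h2 : ((2 : ℤ_[2]) : ℚ_[2]) = 2 := rfl
  rw [htors, hred, hu, add_zero, zpow_natCast]
  push_cast
  simp only [h2]
  ring

/-- **`hEC` from the displayed named fact `h34`** (`Greenberg1999.lemma34_natCard_localTowerKerPrimary_eq_rat`, Lemma 3.4 at
every layer over `ℚ`): on {no rational `2`-torsion} the TOWER doors' binder `hEC : TwoAdicEulerCharRankZero W 0` is a
consequence of `h34` — a binder those doors' `λ`-road / `…_of_greenberg_sharp` forms already carry.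
[cite: GreenbergLNM1716, Thm. 4.1 (p. 85); §3 Lemma 3.4 (p. 89)] -/
theorem twoAdicEulerCharRankZero_of_lemma34 (W : WeierstrassCurve ℚ) [W.IsElliptic] [W.IsGloballyMinimal]
    (h34 : lemma34_natCard_localTowerKerPrimary_eq_rat) (hK : ∀ P : W.toAffine.Point, 2 • P = 0 → P = 0) :
    TwoAdicEulerCharRankZero W 0 :=
  twoAdicEulerCharRankZero_of_layerZeroCount W hK fun hgo κ hκ v hv ↦ (h34 W 2 hgo κ hκ v hv 0).2

/-- **`hEC` from `h34` on the `E[2]`-IRREDUCIBLE locus** (the 440 TOWER rows): `Irr W 2` forces odd torsion order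
(`TowerClass.not_two_dvd_torsionOrder_of_irr`'s argument: a rational point of order `2` spans a stable line), hence no rational
`2`-torsion. [cite: GreenbergLNM1716, Thm. 4.1 (p. 85); §3 Lemma 3.4 (p. 89)] [cite: SilvermanAEC2009, III.2.3 (b)] -/
theorem twoAdicEulerCharRankZero_of_lemma34_of_not_dvd_torsionOrder (W : WeierstrassCurve ℚ) [W.IsElliptic]
    [W.IsGloballyMinimal] (h34 : lemma34_natCard_localTowerKerPrimary_eq_rat) (htors : ¬ 2 ∣ W.torsionOrder) :
    TwoAdicEulerCharRankZero W 0 :=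
  -- (`convert` bridges the two `DecidableEq ℚ` instances behind the group law on `W.toAffine.Point`)
  twoAdicEulerCharRankZero_of_lemma34 W h34 fun P hP ↦
    Rank1Residual.Iwasawa.forall_smul_eq_zero_imp_of_not_dvd_torsionOrder W htors P (by convert hP)

end Summit.BirchSwinnertonDyer.BirchSwinnertonDyer.Theorems.GreenbergEulerChar

end
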